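import Mathlib
import Summits.Ventures.FusionMHD.Models.CerfonFreidbergIterLikeQ25Defs
import HarnessLib

/-!
# Ventures/FusionMHD — Models/CerfonFreidbergIterLikeQ25Panels6.lean: KERNEL CHECK of panels 19, 20 (of 32) of the
# certified safety factor `q(ψ_N = 1/4)/F` of THE Cerfon–Freidberg ITER-like instance (sibling of `…IterLikeQHalfPanels*.lean`)

HONEST FRAMING (LADDER-GRIDFUSION three columns; CF rung, F2 item R2, q-profile sample).  One `decide +kernel` (≈ 60 s on the farm): for
each panel `j` listed, the per-panel obligation `CFIterLike.Q25.PanelCert.ok` (`Models/CerfonFreidbergIterLikeQ25Defs.lean`) — the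
Taylor-model run of `CFIterLike.Q25.progG` over the ITER-like parameter box is ACCEPTED (every `log`/`sin`/`cos` composition and the `inv`
certificate), and the kernel's panel-integral enclosure of the polar `(6.35)` integrand along the approximant, the range of the flux residual
`U(ray m) − 3U_a/4`, the range of the approximant `m` and the range of the radial derivative `D_r(θ, m)` lie inside the integers claimed in
`panelCert6` (values read off a compiled `#eval` of the same functions, slack one unit of `2⁻⁶⁰`; probe `QProbeIF*.lean`, generator
`pub/gridfusion/models/gen-model-5/g8/gen90/mkdefsN.py`).  What these Booleans MEAN (real-number statements, uniformly over the parameter box ∋ THE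
ITER-like instance) is proved once in `Models/CerfonFreidbergIterLikeQ25Sound.lean`.  MODELLED: analytic Cerfon–Freidberg family; `q` of a
MODEL surface — nothing about a device or stability.  No `native_decide`.  Typer/prover: gridfusion-model-5 (g8), 2026-08-27.
Citations: Freidberg 2014 §6.3.5 (6.35) [Freidberg2014]; Mahboubi–Melquiond–Sibut-Pinote 2016 §3.2 Lemma 3 [MahboubiMelquiondSibutpinote2016].
-/

namespace Summit.Ventures.FusionMHD.Models.CFIterLike.Q25

/-- The certificate data of panels 19, 20 (`ψ_N = 1/4`): `inv` candidate (degree-12 fit of `(X·D_r)⁻¹` in the panel variable, scaled by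
`2⁶⁰`), Taylor degree, `inv` widening `2^elog2`, and the claimed integral / residual / `m`-range / `D_r`-range integers (× `2⁶⁰`). [instance data] -/
def panelCert6 : List PanelCert := [
  { j := 19, cand := [17919370967250843648, 8046259124242028544, -260963122758313705472, 130687419558171967488, 7435058823584888651776, -13592679035724254674944, -214924930897828590387200, 750088849525543180173312, 5998592089149027160948736, -33921147082074356275216384, -172981063291869809153671168, 1110685711785596923353759744, 34278053953418026740793475072],
    deg := 10, elog2 := 38, plo := 434645486975069205, phi := 434645502585909282, eta := 190055750, mlo := 281210212214808509, mhi := 289522307415515244,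
    dlo := 76557708881381469, dhi := 77650404313872800 },
  { j := 20, cand := [17926469614328930304, -7070731785309175808, -211783000208000024576, 828207028729339052032, 3220202286013308469248, -32890829873978072367104, 14614971354400654622720, 928379577582270856298496, -3569776241371480938512384, -16480240801654520890261504, 116216882649341332916535296, 125066458014674681413500928, 68221297379106186599419871232],
    deg := 10, elog2 := 38, plo := 421266834793895361, phi := 421266850032024124, eta := 203585253, mlo := 270680144570588077, mhi := 281980353851734850,
    dlo := 77212108028156160, dhi := 80055617173905439 }]

/-- **KERNEL CHECK** of panels 19, 20 of the ITER-like surface `ψ_N = 1/4`. -/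
theorem panelCert6_ok : CFIterLike.Q25.panelCert6.all PanelCert.ok = true := by
  decide +kernel

end Summit.Ventures.FusionMHD.Models.CFIterLike.Q25
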